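import Summits.CriticalPhenomena.SAWScalingLimit.Theorems.ShellCrossingBound.Negative.Forcing6Shell

/-!
# `ShellCrossingBound` — negative knowledge: the UNIFORM-threshold Aizenman–Burchard hypothesis is FALSE for the critical SAW

Support file for crux `stmt-CriticalPhenomena-4728` (refuter `cdisprove`; work file
`Summits/CriticalPhenomena/SAWScalingLimit/Cruxes/ShellCrossingBound/Disproof.lean`). Everything
proved (no `sorry`; axioms `propext, Classical.choice, Quot.sound`).

The crux `SAWRenewalTightness.ShellCrossingBound` lets the traversal threshold `k x ρ R` depend on
the shell; `Negative/OfEventualTight.lean` shows that this freedom collapses the crux onto the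
target `EventualTight`. The natural statement WITH content is the literal Aizenman–Burchard
hypothesis (H1) with ONE threshold `k : ℕ` (the work file's `ShellCrossingBoundUniformK`, inlined here).
This file REFUTES it (`not_uniformThreshold`) by deterministic boundary forcing in the explicit Dobrushin
domain of `Forcing1Domain … Forcing6Shell` (the triangle `(0, 1 ∓ i/4)` sheared along
`√x · sin (π/x)`, marked at the pinch point `0` and at `1 − i/4`): given `k, K, λ > 2, δ₀`, choose
`ε ≤ 1` with `K ε² < 1` and the forcing shell for `(k, ε)`; at a small mesh the `k`-traversal event
is almost sure, so its probability `1` exceeds `K (ρ/R)^λ < K ε² < 1`. Consequence for repairs of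
the crux: uniformity of the threshold can only be asked on interior shells (`closedBall x R ⊆ Ω`,
the work file's `ShellCrossingBoundBulk`). [folklore]
-/

noncomputable section

open Set Filter Topology Metric MeasureTheory Complex
open scoped ENNReal Real
open Literature.Probability.RandomPlanarGeometry Literature.Probability.LatticeModels

namespace Summit.CriticalPhenomena.SAWScalingLimit.Theorems.ShellCrossingBound.Negative

open Forcing

/-! ## G. The uniform-threshold Aizenman–Burchard hypothesis fails for the critical SAW -/

/-- **The uniform-threshold Aizenman–Burchard hypothesis is FALSE for the critical `ℤ²` SAW.**
The negated statement is the crux `SAWRenewalTightness.ShellCrossingBound` with the shell-dependence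
of the threshold removed (ONE `k : ℕ` for all shells; called `ShellCrossingBoundUniformK` in the work
file — inlined here so that no named statement is created). Witness: the domain `forcingDomain` of
`Forcing1Domain … Forcing6Shell` (the triangle `(0, 1 ∓ i/4)` sheared along the damped
topologist's sine `√x sin(π/x)`, marked at the pinch point `0` and at `1 - i/4`) with the endpoint
approximation `(aδ, bδ)` (`isEndpointApprox`): given `k, K, λ > 2, δ₀`, pick `ε ≤ 1` with
`K ε² < 1` and the forcing shell for `(k, ε)` (`forcing`); at the mesh `min δ₀ δ₁` the
`k`-traversal event is almost sure, so its probability `1` exceeds `K (ρ/R)^λ ≤ K (ρ/R)^2 < K ε² < 1`.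
[folklore] -/
theorem not_uniformThreshold :
    ¬ (∀ (D : DobrushinDomain) (a b : ℝ → Site 2), SAW.IsEndpointApprox D a b →
      ∃ (k : ℕ) (K lam δ₀ : ℝ), 2 < lam ∧ 0 < δ₀ ∧ ∀ δ ∈ Set.Ioc (0 : ℝ) δ₀,
        ∀ (x : ℂ) (ρ R : ℝ), δ ≤ ρ → ρ < R → R ≤ 1 →
          SAW.law D.carrier δ (a δ) (b δ)
            {γ | (⟨γ.walk.toCurve (meshPoint δ)⟩ : Curve ℂ).HasTraversals k x ρ R}
              ≤ ENNReal.ofReal (K * (ρ / R) ^ lam)) := by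
  intro hU
  obtain ⟨k, K, lam, δ₀, hlam, hδ₀, H⟩ := hU forcingDomain aδ bδ isEndpointApprox
  -- choose ε with K ε² < 1 and ε ≤ 1
  set ε : ℝ := min 1 (1 / (2 * (max K 1))) with hε
  have hK1 : 1 ≤ max K 1 := le_max_right _ _
  have hε0 : 0 < ε := lt_min one_pos (by positivity)
  have hKε : K * ε ^ 2 < 1 := by
    have h1 : ε ≤ 1 / (2 * max K 1) := min_le_right _ _
    have h2 : K ≤ max K 1 := le_max_left _ _
    have h3 : ε ^ 2 ≤ ε * (1 / (2 * max K 1)) := by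
      rw [sq]; exact mul_le_mul_of_nonneg_left h1 hε0.le
    calc K * ε ^ 2 ≤ max K 1 * (ε * (1 / (2 * max K 1))) :=
          mul_le_mul h2 h3 (sq_nonneg _) (by positivity)
      _ = ε / 2 := by field_simp
      _ < 1 := by linarith [min_le_left (1 : ℝ) (1 / (2 * max K 1))]
  obtain ⟨x, ρ, R, δ₁, hδ₁, hδ₁ρ, hρR, hR1, hratio, hforce⟩ := forcing k hε0
  have hρ : 0 < ρ := hδ₁.trans_le hδ₁ρ
  have hR : 0 < R := hρ.trans hρR
  set δ : ℝ := min δ₀ δ₁ with hδ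
  have hδpos : 0 < δ := lt_min hδ₀ hδ₁
  obtain ⟨hprob, hall⟩ := hforce δ ⟨hδpos, min_le_right _ _⟩
  have hbound := H δ ⟨hδpos, min_le_left _ _⟩ x ρ R ((min_le_right _ _).trans hδ₁ρ) hρR hR1
  have hev : {γ : SAW.DomainSAW forcingDomain.carrier δ (aδ δ) (bδ δ) |
      (⟨γ.walk.toCurve (meshPoint δ)⟩ : Curve ℂ).HasTraversals k x ρ R} = Set.univ :=
    Set.eq_univ_of_forall fun γ => hall γ
  rw [hev, measure_univ] at hbound
  have hq0 : 0 < ρ / R := div_pos hρ hR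
  have hq1 : ρ / R < 1 := (div_lt_one hR).2 hρR
  have hpow : (ρ / R) ^ lam ≤ (ρ / R) ^ (2 : ℝ) :=
    Real.rpow_le_rpow_of_exponent_ge hq0 hq1.le hlam.le
  have hsq : (ρ / R) ^ (2 : ℝ) < ε ^ 2 := by
    rw [Real.rpow_two]
    exact pow_lt_pow_left₀ hratio hq0.le two_ne_zero
  have hlt : K * (ρ / R) ^ lam < 1 := by
    by_cases hK : 0 ≤ K
    · calc K * (ρ / R) ^ lam ≤ K * (ρ / R) ^ (2 : ℝ) := mul_le_mul_of_nonneg_left hpow hK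
        _ ≤ K * ε ^ 2 := mul_le_mul_of_nonneg_left hsq.le hK
        _ < 1 := hKε
    · have : K * (ρ / R) ^ lam ≤ 0 :=
        mul_nonpos_of_nonpos_of_nonneg (not_le.1 hK).le (Real.rpow_nonneg hq0.le _)
      linarith
  have : ENNReal.ofReal (K * (ρ / R) ^ lam) < 1 := by
    rw [← ENNReal.ofReal_one]
    exact (ENNReal.ofReal_lt_ofReal_iff one_pos).2 hlt
  exact absurd hbound (not_le.2 this)

end Summit.CriticalPhenomena.SAWScalingLimit.Theorems.ShellCrossingBound.Negative
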